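import Literature.MathematicalPhysics.QuantumFieldTheory.Balaban1983to89.B13DomainKernelWalks

/-!
# `Balaban1983to89.B13DomainKernelWalksDecay` — [Balaban1985BackgroundPropagators] Thm 3.10 (3.108) p. 416 read at walk
length 1 with PASSAGE-DECAYING ENTRIES: domain-localised one-step operator families (`B13DomainKernelWalks.DomainTerms`)
whose entries decay along the one-point passage `y → X_b ∩ X → y′` are `JointWalkExpansion`s with amplitude `λe^{κ₁m_J}` —
NO `e^{2ρr}` — and torus-uniform constant `K̄ = λe^{κ₁m_J}·e^{μr}·n_D·c_μ`

statement-level skeleton of published theorems with citation tags; proofs where landed; nothing here is a claim about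
the Yang–Mills mass gap

CITATION HEADER: as `B13DomainKernelWalks` ([B9] Thm 3.10 (3.107)–(3.108) p. 416, (3.93) p. 410; [II] = CMP **116**
(1988) (1.11) p. 5, p. 13, p. 15; [B6] Lemma 2.1 (2.61) p. 234).  [B9] p. 409 (3.89): *"|(K(h_□)G′_□h_□λ)(x)| ≤
O(M⁻¹)e^{−δ₀|y−y′|}|λ|"* — the printed one-step factor IS entrywise decaying.

PROVENANCE.  Cell `pub-balaban-gaps`, row (D4) NODE O: rung R5c (c1) of g1-plan-1's `g1/ROUTES-PLAN-1.md` §2 note 23,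
TYPED AND CHECKED by planner seat g1-plan-1 GEN 12 over this seat's `B13DomainKernelWalks` letters as the HOME appendix
`pub-balaban-gaps-g1-plan-1/skel8_R5c_domainLocalD.mono.NOT-TO-FILE.lean` sha16 00b13f79c1e4d75e (lines 330–447), offered
«cite-and-build» [G1-PLAN1-G12-SKELETON-8-OFFER]; FILED by prover seat g1-p2 GEN 4 with the namespace moved under
`Balaban1983to89` and nothing else changed (declarations byte-identical to the appendix).
WHAT IT DOES.  `IsDomainLocalD` = `IsDomainLocal` with the flat entry bound `hbd : ‖F_b(u) i j‖ ≤ λ` replaced by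
`hbdD : ‖F_b(u) i j‖ ≤ λ·e^{−ρ·D_b(loc i, loc j)}` (`D_b` = the one-point distance of `B13DomainKernelWalks`); `toFlat`
(an R5c datum is an INTENT-21 datum); `norm_term_le_D`; `jointWalkExpansion_domainLocalD` (amplitude `λe^{κ₁m_J}`, constant
`λe^{κ₁m_J}·e^{μr}·n_D·c_μ`, the anchor-summation rate `μ` free); `walkMajorants_domainLocalD`.  With these letters the
σ-line of `SmallTheta` is a condition on the GEOMETRY (`R_σ`, `α∕R`) at fixed `λ` (g1-plan-1 finding N21-1 no longer applies).
HONEST FRAMING: MODEL-level variant (finite sums, one row sum); nothing of Bałaban's `Γ_k ∕ Δ^{(k)} ∕ C^{(k)}` asserted —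
whether THEY satisfy `hbdD` with k-uniform letters is row (D4)'s open OBJECT-level content; (D4) instance 0∕1; NOT B12
Thm 2, NOT `BetaPertH`, NOT continuum ∕ ℝ⁴, NOT mass gap, NOT Clay.
-/

noncomputable section

namespace Literature.MathematicalPhysics.QuantumFieldTheory.Balaban1983to89.B13DomainKernelWalksDecay

open Metric Set Finset
open Literature.MathematicalPhysics.QuantumFieldTheory.Balaban1983to89
open Literature.MathematicalPhysics.QuantumFieldTheory.Balaban1983to89.B13DomainKernelWalks
open Literature.MathematicalPhysics.QuantumFieldTheory.Balaban1983to89.B9SectDWalk (Through MajSumLe DomBy)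
open Literature.MathematicalPhysics.QuantumFieldTheory.Balaban1983to89.B9Thm34Ext (toB6)
open Literature.MathematicalPhysics.QuantumFieldTheory.Balaban1983to89.B9Thm37GlueTorus (torusGeom tdist1 tdist1_nonneg)
open Literature.MathematicalPhysics.QuantumFieldTheory.Balaban1983to89.TreeLengthTorus (TPt)
open Literature.MathematicalPhysics.QuantumFieldTheory.Balaban1983to89.B5TorusCover (UT)
open Literature.MathematicalPhysics.QuantumFieldTheory.Balaban1983to89.B11SectG (RowSum)
open Literature.MathematicalPhysics.QuantumFieldTheory.Balaban1983to89.B13JointWalkExpansion (JointWalkExpansion WalkMajorants)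

variable {d N' : ℕ} {ν : ℕ} {Nf : Fin ν → ℕ} [∀ i, NeZero (Nf i)]
variable {p n : Type}
variable {E : Type*} [NormedAddCommGroup E] [NormedSpace ℂ E]

/-- **DOMAIN LOCALITY WITH PASSAGE-DECAYING ENTRIES** (rung R5c (c1); Prop-valued hypothesis shape): INTENT-21's `IsDomainLocal`
with the flat entry bound replaced by `hbdD : ‖F_b(u) i j‖ ≤ λ·e^{−ρ·D_b(loc i, loc j)}`, `D_b` = INTENT-21's one-point distance
through `X_b ∩ X` (resp. `X_b`). [cite: Balaban1985BackgroundPropagators, Thm 3.10 (3.108) p.416, (3.93) p.410; Balaban1988RG2Cluster, (1.11) p.5, p.13] -/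
structure IsDomainLocalD (L : DomainTerms d N' ν Nf p n E) (c : B13.Consts) (locp : p → UT Nf) (locn : n → UT Nf)
    (X : Finset (UT Nf)) (R lam ρ r : ℝ) (mJ nD : ℕ) : Prop where
  hanchor : ∀ b, L.anchor b ∈ L.dom b
  hsupp : ∀ b u i j, L.op b u i j ≠ 0 → locp i ∈ L.dom b ∧ locn j ∈ L.dom b
  han : ∀ b i j, DifferentiableOn ℂ (fun u => L.op b u i j) (ball (0 : E) R)
  hbdD : ∀ b, ∀ u ∈ ball (0 : E) R, ∀ i j, ‖L.op b u i j‖ ≤ lam * Real.exp (-(ρ * L.dist X b (locp i) (locn j)))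
  hdiam : ∀ b, ∀ z ∈ L.dom b, ∀ z' ∈ L.dom b, tdist1 Nf z z' ≤ r
  hJ : ∀ b, (L.J b).card ≤ mJ
  hX : ∀ b, (L.J b).Nonempty → (L.dom b ∩ X).Nonempty
  hmult : ∀ z : UT Nf, (Finset.univ.filter fun b => L.anchor b = z).card ≤ nD

variable {L : DomainTerms d N' ν Nf p n E}
variable {c : B13.Consts} {locp : p → UT Nf} {locn : n → UT Nf} {X : Finset (UT Nf)} {R lam ρ r : ℝ} {mJ nD : ℕ}

/-- Passage-decaying entries are in particular flat-bounded by `λ` (`ρ ≥ 0`): R5c's datum IS an INTENT-21 datum, so every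
INTENT-21 theorem (in particular `majSumLe_domainLocal`) applies to it. [cite: Balaban1985BackgroundPropagators, (3.108) p.416] -/
theorem IsDomainLocalD.toFlat (hL : IsDomainLocalD L c locp locn X R lam ρ r mJ nD) (hρ : 0 ≤ ρ) (hlam : 0 ≤ lam) :
    L.IsDomainLocal c locp locn X R lam r mJ nD where
  hanchor := hL.hanchor
  hsupp := hL.hsupp
  han := hL.han
  hbd b u hu i j := by
    have h := hL.hbdD b u hu i j
    have h1 : Real.exp (-(ρ * L.dist X b (locp i) (locn j))) ≤ 1 :=
      Real.exp_le_one_iff.2 (by have := L.dist_nonneg X b (locp i) (locn j); nlinarith)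
    calc ‖L.op b u i j‖ ≤ lam * Real.exp (-(ρ * L.dist X b (locp i) (locn j))) := h
      _ ≤ lam * 1 := mul_le_mul_of_nonneg_left h1 hlam
      _ = lam := mul_one _
  hdiam := hL.hdiam
  hJ := hL.hJ
  hX := hL.hX
  hmult := hL.hmult

/-- **THE PER-TERM BOUND with passage-decaying entries**: `‖T_b(σ,u)(i,j)‖ ≤ λe^{κ₁m_J}·e^{−ρD_b(loc i, loc j)}` — NO `e^{2ρr}`.
[cite: Balaban1985BackgroundPropagators, (3.108) p.416; Balaban1988RG2Cluster, (1.11) p.5] -/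
theorem norm_term_le_D (hL : IsDomainLocalD L c locp locn X R lam ρ r mJ nD) (hκ₁ : 0 ≤ c.κ₁)
    (b : L.B) (σ : TPt d N' → ℂ) (hσ : ∀ j, ‖σ j‖ ≤ Real.exp c.κ₁) (u : E) (hu : u ∈ ball (0 : E) R) (i : p) (j : n) :
    ‖L.term b σ u i j‖ ≤ (lam * Real.exp (c.κ₁ * mJ)) * Real.exp (-(ρ * L.dist X b (locp i) (locn j))) := by
  rw [L.term_apply, norm_mul]
  have h1 := DomainTerms.norm_monomial_le hκ₁ (hL.hJ b) σ hσ
  have h2 := hL.hbdD b u hu i j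
  calc ‖∏ j ∈ L.J b, σ j‖ * ‖L.op b u i j‖
      ≤ Real.exp (c.κ₁ * mJ) * (lam * Real.exp (-(ρ * L.dist X b (locp i) (locn j)))) :=
        mul_le_mul h1 h2 (norm_nonneg _) (Real.exp_pos _).le
    _ = (lam * Real.exp (c.κ₁ * mJ)) * Real.exp (-(ρ * L.dist X b (locp i) (locn j))) := by ring

/-- **RUNG R5c (c1): DOMAIN-LOCALISED FAMILIES WITH PASSAGE-DECAYING ENTRIES ARE JOINT WALK EXPANSIONS, amplitude `λe^{κ₁m_J}`,
constant `K̄ = λe^{κ₁m_J}·e^{μr}·n_D·c_μ`** — INTENT-21's theorem with ONE letter changed; `λ, κ₁, ρ ≥ 0`, drop `ε`, `κ, μ ≥ 0`,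
`κ + μ ≤ ρ − ε`, (2.61) at rate `μ` (free: `μ = O(1/M)` when `r = O(M)` keeps `e^{μr} = O(1)`).  With these letters θ's σ-line is a
condition on `R_σ, R` at FIXED λ (finding N21-1 no longer applies). [cite: Balaban1985BackgroundPropagators, Thm 3.10 (3.107)–(3.108) p.416, (3.93) p.410; Balaban1988RG2Cluster, (1.11) p.5, p.13, p.15; Balaban1984PropagatorsII, (2.61) p.234] -/
theorem jointWalkExpansion_domainLocalD (hL : IsDomainLocalD L c locp locn X R lam ρ r mJ nD) (hκ₁ : 0 ≤ c.κ₁)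
    (hlam : 0 ≤ lam) {ε κ μ cμ : ℝ} (hρ : 0 ≤ ρ) (hκ : 0 ≤ κ) (hμ : 0 ≤ μ) (hwin : κ + μ ≤ ρ - ε)
    (hrow : RowSum (toB6 (torusGeom Nf 0 0 0) 0 True) μ cμ) :
    JointWalkExpansion c locp locn L.kernel X R ε κ
      ((lam * Real.exp (c.κ₁ * mJ)) * Real.exp (μ * r) * (nD * cμ))
      L.term L.sigmaCarrying (fun _ => lam * Real.exp (c.κ₁ * mJ)) (L.dist X) ρ where
  hasSum σ hσ u hu i j := by
    rw [L.kernel_apply]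
    exact hasSum_fintype _
  termAnalytic b σ hσ i j := by
    have h : (fun u => L.term b σ u i j) = fun u => (∏ j ∈ L.J b, σ j) * L.op b u i j :=
      funext fun u => L.term_apply b σ u i j
    rw [h]
    exact (differentiableOn_const _).mul (hL.han b i j)
  maj b σ hσ u hu i j := norm_term_le_D hL hκ₁ b σ hσ u hu i j
  majSum := DomainTerms.majSumLe_domainLocal (hL.toFlat hρ hlam) (by positivity) hκ hμ hwin hrow
  indep b hb σ hσ := by
    have hJ : L.J b = ∅ := Finset.not_nonempty_iff_eq_empty.1 hb
    simp [DomainTerms.term, hJ]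
  through b hb := L.through_dist (hL.hX b hb)
  A_nonneg _ := by positivity
  D_nonneg b a a' := L.dist_nonneg X b a a'

/-- The covariance-slot triple for the R5c datum (`ε = 0`). [cite: Balaban1985BackgroundPropagators, (3.108) p.416] -/
theorem walkMajorants_domainLocalD (hL : IsDomainLocalD L c locp locn X R lam ρ r mJ nD) (hκ₁ : 0 ≤ c.κ₁) (hlam : 0 ≤ lam)
    {κ μ cμ : ℝ} (hρ : 0 ≤ ρ) (hκ : 0 ≤ κ) (hμ : 0 ≤ μ) (hwin : κ + μ ≤ ρ)
    (hrow : RowSum (toB6 (torusGeom Nf 0 0 0) 0 True) μ cμ) :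
    WalkMajorants c locp locn L.kernel R κ ((lam * Real.exp (c.κ₁ * mJ)) * Real.exp (μ * r) * (nD * cμ))
      L.term (fun _ => lam * Real.exp (c.κ₁ * mJ)) (L.dist X) ρ := by
  have h := jointWalkExpansion_domainLocalD hL hκ₁ hlam (ε := 0) hρ hκ hμ (by simpa using hwin) hrow
  exact ⟨h.hasSum, h.maj, by simpa using h.majSum, h.A_nonneg⟩

end Literature.MathematicalPhysics.QuantumFieldTheory.Balaban1983to89.B13DomainKernelWalksDecay

end
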